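import Mathlib
import HarnessLib
import Summits.Parity.GeneralizedHardyLittlewood.Theses.LeeYangFibres
import Summits.Parity.GeneralizedHardyLittlewood.Theorems.LeeYangFibresAbsoluteUpgradeDipDefs
import Literature.Barriers.Parity.SiegelZeroDichotomy

/-!
# Crux `FibreHyperbolicityAlong` (stmt-Parity-18103) — strategist sketch (typed statements only)

Companion to `Cruxes/FibreHyperbolicityAlong/STRATEGY-CENSUS.md` (crux-strategist seat
`planner-cstrat-stmt-Parity-18103-0`, 2026-08-17).  NOTHING HERE IS A ROUTE ITEM: every `def … : Prop`
is a statement typed so that the census can point at a signature, and every `theorem … := by sorry`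
is a SIGNATURE ONLY (the census says which are provable now, which are the crux in other clothes).
The two sorry-free theorems (`crux_iff_dip`, `flat_of_crux`) are bookkeeping.

Dictionary.  `U(N) = slowDegree N = max 4 ⌊√(log log N)/2⌋`; joint cells `jointCell`, fibres `fibre`
(`Cruxes.FibreHyperbolicity.ModelTransfer`); Buchstab–Dickman row `I_{j+1}(u) = cellDensity j u`;
`λ(m) = (-1)^{Ω(m)}` written inline through `ArithmeticFunction.cardFactors`.

* §1  `SiftedChowlaAlongExp` / `SiftedChowlaAlongPoly` / `SiftedSinglesAlong` — the Walsh (parity)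
      content of the crux: Liouville correlations over the ROUGH tuples of `(Ψ, K)` along the schedule,
      with saving `e^{-C·U(N)}` for every `C` (Exp), resp. `U(N)^{-m}` for every `m` (Poly), uniformly in
      shifts `≤ LN`.  Singles (`|S| = 1`) are provable now; `|S| ≥ 2` is sifted `k`-point Chowla.
* §2  `RobustRowExp` — parity-free: the real-rootedness ROBUSTNESS RADIUS of the Buchstab–Dickman row is
      at least `e^{-Cu}` for some `C` (numerically `θ*(u) ≈ 7.5·e^{-0.94u}` to `u = 300`).  The converse
      companion of the landed `MarginPoly` (which says tilts `≥ u^{-m}` DESTROY real-rootedness).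
* §3  `FlatFibreHyperbolicityAlong` — the `w = (1,…,1)` face of the crux (a genuine special case,
      `flat_of_crux`), provable from `RobustRowExp` by the structured-sequence sieve in the fundamental-lemma
      regime `s = U/2 → ∞` (accuracy `(U/2)^{-U/2} ≪ e^{-CU}`).
* §4  `PrimeColumnHyperbolicAlong` — the `w → 0⁺` face (necessity object, cf. the fixed-degree
      `primeColumn_hyperbolic_of_fibreHyperbolicity`, p97241).
* §5  The census signatures: DISTILLATION `Law → SiftedChowlaAlongExp → RobustRowExp → crux`,
      NECESSITY `Law → crux → SiftedChowlaAlongPoly`, BYPASS `Law → SiftedChowlaAlongPoly → DimOne`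
      (zeros not needed); the Siegel necessity is recorded as the statement `SiegelKillsCrux`.
-/

noncomputable section

namespace Summit.Parity.GeneralizedHardyLittlewood.Cruxes.FibreHyperbolicityAlong.Strategist

open scoped BigOperators Classical
open Literature.NumberTheory.Sieve
open Summit.Parity.GeneralizedHardyLittlewood.Theses.LeeYangFibres (DimOne CellParityLawSaving)
open Summit.Parity.GeneralizedHardyLittlewood.Cruxes.AbsoluteUpgrade.DipMarginRateExchange (slowDegree)
open Summit.Parity.GeneralizedHardyLittlewood.Cruxes.ModelHyperbolicity.WindowChainTransport (cellDensity)
open Summit.Parity.GeneralizedHardyLittlewood.Cruxes.FibreHyperbolicity.ModelTransfer (jointCell fibre)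

/-- The route crux (stmt-Parity-18103) in the factored vocabulary of the dip line: definitional. -/
theorem crux_iff_dip :
    Theses.LeeYangFibres.FibreHyperbolicityAlong ↔
      AbsoluteUpgrade.DipMarginRateExchange.FibreHyperbolicityAlong := Iff.rfl

/-! ## §1 The parity content: sifted Liouville correlations along the schedule -/

/-- The rough tuples of `(Ψ, K)` at scale `N` and roughness `N^{1/u}`: lattice points `n` of the box with
`realPoint n ∈ K` and every value `ψ_k(n)` `N^{1/u}`-rough (the union over `j` of the joint cells). -/
def roughTuples (t N u : ℕ) (Ψ : Fin t → AffLinForm 1) (K : Set (Fin 1 → ℝ)) : Finset (Fin 1 → ℤ) :=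
  (latticeBox 1 N).filter (fun n => realPoint n ∈ K ∧
    ∀ k, (N : ℝ) ^ ((1 : ℝ) / u) < (Nat.minFac ((Ψ k).eval n).toNat : ℝ))

/-- The sifted Liouville correlation `Σ_{n rough tuple} ∏_{i ∈ S} λ(ψ_i(n))`, `λ = (-1)^Ω`. -/
def siftedLiouvilleCorr (t N u : ℕ) (Ψ : Fin t → AffLinForm 1) (K : Set (Fin 1 → ℝ))
    (S : Finset (Fin t)) : ℤ :=
  ∑ n ∈ roughTuples t N u Ψ K, ∏ i ∈ S, (-1 : ℤ) ^ ArithmeticFunction.cardFactors ((Ψ i).eval n).toNat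

/-- **Sifted Chowla along the schedule, exponential saving** (`RTC_exp`): for every `t, L` and every
`C`, eventually in `N`, every non-empty sign set `S` has
`|Σ_{rough tuples} ∏_{i∈S} λ(ψ_i(n))| ≤ e^{-C·U(N)} · N · U(N)^t / (log N)^t`, uniformly over admissible
`Ψ` (shifts `≤ LN`) and convex `K`.  (The number of rough tuples is `≍ β_∞𝔖 (U ω(U)/log N)^t`, at most
`C(t,L) N (log log N)^{t-1} U^t/(log N)^t`, so this is a saving `e^{-C√(log log N)/2}·(log log N)^{O(t)}`
over the trivial bound — weaker than any `(log N)^{-ε}`, stronger than any power of `log log N`.)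
`|S| = 1`: provable now (`SiftedSinglesAlong`).  `|S| ≥ 2`: sifted `|S|`-point Chowla at a fixed system,
natural density, shift-uniform — the parity content of the crux (census §2). -/
def SiftedChowlaAlongExp : Prop :=
  ∀ (t L : ℕ), 1 ≤ t → ∀ C : ℝ, ∃ N₀ : ℕ, ∀ N : ℕ, N₀ ≤ N →
    ∀ Ψ : Fin t → AffLinForm 1, IsNondegenerateSystem Ψ → affLinSize Ψ N ≤ L →
    ∀ K : Set (Fin 1 → ℝ), Convex ℝ K → K ⊆ realBox 1 N →
    ∀ S : Finset (Fin t), S.Nonempty →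
      |(siftedLiouvilleCorr t N (slowDegree N) Ψ K S : ℝ)| ≤
        Real.exp (-(C * slowDegree N)) * N * (slowDegree N : ℝ) ^ t / Real.log N ^ t

/-- **Sifted Chowla along the schedule, polynomial saving** (`RTC_poly`): as above with `U(N)^{-m}` for
every `m` in place of `e^{-CU}` for every `C`.  This is what the crux together with the law DELIVERS
(`necessity`, via the landed `quantClip_thetaSmall` + `MarginPoly`), and it is ALL that `closes` consumes
(`bypass`). -/
def SiftedChowlaAlongPoly : Prop :=
  ∀ (t L : ℕ), 1 ≤ t → ∀ m : ℕ, ∃ N₀ : ℕ, ∀ N : ℕ, N₀ ≤ N →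
    ∀ Ψ : Fin t → AffLinForm 1, IsNondegenerateSystem Ψ → affLinSize Ψ N ≤ L →
    ∀ K : Set (Fin 1 → ℝ), Convex ℝ K → K ⊆ realBox 1 N →
    ∀ S : Finset (Fin t), S.Nonempty →
      |(siftedLiouvilleCorr t N (slowDegree N) Ψ K S : ℝ)| ≤
        ((slowDegree N : ℝ) ^ m)⁻¹ * N * (slowDegree N : ℝ) ^ t / Real.log N ^ t

/-- **Sifted singles along the schedule** (the `|S| = 1` case of `SiftedChowlaAlongExp`): the Liouville
function of ONE form summed over the rough tuples is super-exponentially small in `U`.  Provable now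
(census §3 flat face / S-provable): sieve the other `t-1` forms out of the structured sequences
`{n : ψ_i(n) ∈ E_a(N^{1/U})}` (products of exactly `a` primes `> N^{1/U}`) with the fundamental lemma at
`s = U(1/2 - ε) → ∞` (relative accuracy `e^{-s log s + O(s log log s)}`, HalberstamRichert1974 Thm 2.5 /
Greaves2001 §3.3 — to vendor; the tree's `fundamental_lemma_uniform` has only `e^{-s}`), Bombieri–Vinogradov
for `E_a`-numbers along one form (tree: `BombieriFriedlanderIwaniecTheorem0b_holds`, Motohashi1976), and
Alladi's cell asymptotics in progressions with the de la Vallée Poussin rate (tree pattern `AnatomyAlong`,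
PROVED): the unsigned anatomy error `e^{-U²}` already dominates the signed Buchstab sum
`Σ_m (-1)^m I_m(U) = -ρ(U-1)` (Dickman). -/
def SiftedSinglesAlong : Prop :=
  ∀ (t L : ℕ), 1 ≤ t → ∀ C : ℝ, ∃ N₀ : ℕ, ∀ N : ℕ, N₀ ≤ N →
    ∀ Ψ : Fin t → AffLinForm 1, IsNondegenerateSystem Ψ → affLinSize Ψ N ≤ L →
    ∀ K : Set (Fin 1 → ℝ), Convex ℝ K → K ⊆ realBox 1 N →
    ∀ i : Fin t,
      |(siftedLiouvilleCorr t N (slowDegree N) Ψ K {i} : ℝ)| ≤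
        Real.exp (-(C * slowDegree N)) * N * (slowDegree N : ℝ) ^ t / Real.log N ^ t

theorem singles_of_exp (h : SiftedChowlaAlongExp) : SiftedSinglesAlong := by
  intro t L ht C
  obtain ⟨N₀, hN⟩ := h t L ht C
  exact ⟨N₀, fun N hN' Ψ hΨ hL K hK hKb i => hN N hN' Ψ hΨ hL K hK hKb {i} (Finset.singleton_nonempty i)⟩

/-! ## §2 The parity-free analysis: robustness radius of the Buchstab–Dickman row -/

/-- **Robust row, exponential radius** (parity-free; pure real/complex analysis on `cellDensity`).
There are `C > 0` and `u₀` such that for every integer `u ≥ u₀`, every real row `b` within RELATIVE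
distance `e^{-Cu}` of the row `(I_{j+1}(u))_{j<u}` — the top index `j = u-1`, where `I_u(u) = 0`, being
allowed a free coefficient of size `≤ e^{-Cu} I_{u-1}(u)` — has only real zeros.  Equivalently (alternating
perturbations are extremal) the robustness radius `θ*(u) = min_k dip_k(u)` of the row is `≥ e^{-Cu}`:
numerically `log₁₀ θ*(u) = -0.41u + 0.9` for `4 ≤ u ≤ 300` (cdisprove kit j013962/j014024, FLINT-certified),
predicted by the two-term Laplace formula `π F(u,-x) = P(x) cos πx − A(x) sin πx` of
`Cruxes/FibreHyperbolicity/DisproofAnalysis.md` §2 (validated to 4 digits, unproved).  What is PROVED is the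
disc regime `|z| ≤ K` (`ModGammaDisc`, p114853 chain) and the destructive direction (`MarginPoly`).  Proof
obligation: uniform asymptotics of `L⁻¹[s⁻¹exp(zE₁(s))](u-1)` for `-x = z ∈ [-Cu, 0]` through the
edge/steepest-descent regime `x/u < 1/e`, the Airy merge at `x/u ≈ 1/e` and the Lambert-`W` / lacunary top
(card hankel-dip-ladder; XL).  Needed with ANY `C` by every coefficient-based proof of the crux; `C < 0.94`
would contradict the numerics, so the content is `∃ C ∈ [0.95, ∞)`. -/
def RobustRowExp : Prop :=
  ∃ C : ℝ, 0 < C ∧ ∃ u₀ : ℕ, ∀ u : ℕ, u₀ ≤ u → ∀ b : ℕ → ℝ,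
    (∀ j : ℕ, j < u →
      |b j - cellDensity j u| ≤
        Real.exp (-(C * u)) * (cellDensity j u + if j + 1 = u then cellDensity (u - 2) u else 0)) →
    ∀ z : ℂ, (∑ j ∈ Finset.range u, (b j : ℂ) * z ^ j) = 0 → z.im = 0

/-! ## §3 The flat face `w = (1,…,1)` — a genuine, provable special case of the crux -/

/-- **Flat fibre hyperbolicity along the schedule**: the crux with every frozen fugacity equal to `1`
("the other forms merely rough").  Its coefficients `b_m^{(i)}(1) = #{n : Ω(ψ_i(n)) = m, every ψ_k(n)
N^{1/U}-rough}` pin `Ω` on ONE form only and sift the others: sieve-visible, no parity obstruction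
(idea card `Cruxes/FibreHyperbolicity/Ideas/sieve-accuracy-beats-margin.md`, triage r1-1/r1-2: pass). -/
def FlatFibreHyperbolicityAlong : Prop :=
  ∀ (t L : ℕ), 1 ≤ t → ∀ η : ℝ, 0 < η → ∃ N₀ : ℕ, ∀ N : ℕ, N₀ ≤ N →
    ∀ Ψ : Fin t → AffLinForm 1, IsNondegenerateSystem Ψ → affLinSize Ψ N ≤ L →
    ∀ K : Set (Fin 1 → ℝ), Convex ℝ K → K ⊆ realBox 1 N →
    η * (N : ℝ) ≤ archFactor Ψ K * singularProduct Ψ →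
    ∀ i : Fin t, ∀ ζ : ℂ, fibre t N (slowDegree N) Ψ K i (fun _ => 1) ζ = 0 → ζ.im = 0

/-- The flat face IS a special case of the crux (sorry-free). -/
theorem flat_of_crux (h : Theses.LeeYangFibres.FibreHyperbolicityAlong) : FlatFibreHyperbolicityAlong := by
  intro t L ht η hη
  obtain ⟨N₀, hN⟩ := (crux_iff_dip.1 h) t L ht η hη
  refine ⟨N₀, fun N hN' Ψ hΨ hL K hK hKb hm i ζ hz => ?_⟩
  exact hN N hN' Ψ hΨ hL K hK hKb hm i (fun _ => 1) (fun _ => ⟨one_pos, le_rfl⟩) ζ hz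

/-- **Flat face from the robust row** (census §3: PROVABLE NOW modulo vendoring the sharp fundamental lemma;
all other inputs are in the tree).  Signature only. -/
theorem flatFace_of_robustRow : RobustRowExp → FlatFibreHyperbolicityAlong := by
  sorry

/-! ## §4 The prime-column face `w → 0⁺` — necessity object -/

/-- **Prime-column hyperbolicity along the schedule**: for every coordinate `i`, the `Ω`-profile of
`ψ_i(n)` over the `n` at which every OTHER form is PRIME (`> N^{1/U}`) is the zero polynomial or has only
real zeros.  Necessary for the crux (`w → 0⁺` + Hurwitz + the norm lemma of p97241's companion file, along
the schedule verbatim); parity-sensitive (a pair ghost `θ = ±1` makes it even/odd); open in both directions. -/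
def PrimeColumnHyperbolicAlong : Prop :=
  ∀ (t L : ℕ), 1 ≤ t → ∀ η : ℝ, 0 < η → ∃ N₀ : ℕ, ∀ N : ℕ, N₀ ≤ N →
    ∀ Ψ : Fin t → AffLinForm 1, IsNondegenerateSystem Ψ → affLinSize Ψ N ≤ L →
    ∀ K : Set (Fin 1 → ℝ), Convex ℝ K → K ⊆ realBox 1 N →
    η * (N : ℝ) ≤ archFactor Ψ K * singularProduct Ψ →
    ∀ i : Fin t,
      (∀ m ∈ Finset.Icc 1 (slowDegree N),
          jointCell t N (slowDegree N) Ψ K (Function.update (fun _ => 1) i m) = 0) ∨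
      (∀ z : ℂ, (∑ m ∈ Finset.Icc 1 (slowDegree N),
          (jointCell t N (slowDegree N) Ψ K (Function.update (fun _ => 1) i m) : ℂ) * z ^ m) = 0 →
        z.im = 0)

/-- Necessity of the prime column (signature; proof = p97241/its hyperbolic companion with `u := U(N)`). -/
theorem primeColumn_of_crux :
    Theses.LeeYangFibres.FibreHyperbolicityAlong → PrimeColumnHyperbolicAlong := by
  sorry

/-! ## §5 The census signatures -/

/-- **DISTILLATION (census D3).**  Given the law, exponential sifted Chowla and the robust row give the crux:
cells `= Θ(parity j)·M_j + O(N(log N)^{-t-δ})` (law) with `|θ_S| ≤ C_t e^{-CU}` (Walsh inversion of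
`SiftedChowlaAlongExp` against the rank-one model; anatomy `AnatomyAlong`, PROVED) make every fibre
coefficient row a relative-`e^{-C'U}` perturbation of a positive multiple of the Buchstab–Dickman row, which
`RobustRowExp` keeps real-rooted.  Each step exists in the tree at fixed `u` (`ModelTransfer.stub_perturb`,
`stub_coeffBound`, `fibreExpand`, `stub_assemble`, p86687–p88012) or along the schedule (`QuantClip*`).
Signature only — the census records why this is NOT filed as a line (the open stub `SiftedChowlaAlongExp`
for `|S| ≥ 2` is summit-adjacent and, with the law, bypasses the crux: `bypass`). -/
theorem distillation :
    CellParityLawSaving → SiftedChowlaAlongExp → RobustRowExp →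
      Theses.LeeYangFibres.FibreHyperbolicityAlong := by
  sorry

/-- **NECESSITY (census §2.2).**  Given the law, the crux forces polynomial sifted Chowla: the landed
quantitative clipping `quantClip_thetaSmall` (`|θ_S| ≤ 8^{t-1}(2^t ϑ + 4ν₀)` at every tilt threshold
`ϑ = U^{-m}` of `MarginPoly`, PROVED) plus Walsh inversion.  So modulo the law and parity-free analysis,
`SiftedChowlaAlongExp ⟹ crux ⟹ SiftedChowlaAlongPoly`.  Signature only. -/
theorem necessity :
    CellParityLawSaving → Theses.LeeYangFibres.FibreHyperbolicityAlong → SiftedChowlaAlongPoly := by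
  sorry

/-- **BYPASS (census §2.3).**  The law and POLYNOMIAL sifted Chowla already give `DimOne` — no zero locus:
`Θ(1,…,1) = Σ_S θ_S = 1 + O(2^t C_t U^{-m})`, `(log log N)^{t-1} ≤ (2U+2)^{2t-2}`, so the prime cell is
absolute to `εN/log^t N` and `CellsToDimOne` (p100021, PROVED) finishes.  Hence `closes` consumes strictly
less parity decay (`U^{-m}`) than a proof of the crux must produce (`e^{-CU}`, `RobustRowExp` being sharp up
to the constant).  Signature only. -/
theorem bypass : CellParityLawSaving → SiftedChowlaAlongPoly → DimOne := by
  sorry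

/-- **SIEGEL (census N2)** — recorded as a STATEMENT, deliberately not as a (sorried) theorem, so that no
negative edge on the route item is created by this sketch.  Under zeros of unbounded quality the crux fails:
for the resonant pair `(n, n + q)` (`q` an exceptional conductor, `N` in the Siegel range) `λ ≈ χ` on rough
values and `χ(n)χ(n+q) = 1`, so the joint cell matrix is asymptotically CHECKERBOARD (`θ_{12} = +1`) and the
fibre in coordinate `0` at small `w` has discriminant `→ -4 C₁₁ C₃₁ w² < 0` at `U = 4` (an odd/even split at
every `U`).  Same Siegel-sensitivity as `DimOne` itself (MatomakiMerikoski2023 Thm 1.3); a disprover who lands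
it HOLDS the item on `UnboundedSiegelZeros`, exactly like the target — it does not separate the crux from the
summit. -/
def SiegelKillsCrux : Prop :=
  Literature.Barriers.Parity.UnboundedSiegelZeros → ¬ Theses.LeeYangFibres.FibreHyperbolicityAlong

end Summit.Parity.GeneralizedHardyLittlewood.Cruxes.FibreHyperbolicityAlong.Strategist
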